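import Summits.QuantumFields.YangMills.Theorems.BalabanUVNodesN15TwoSpacingGluingNeumannKnitDefect
import Summits.QuantumFields.YangMills.Theorems.BalabanUVNodesN15TwoSpacingGluingNeumannRemainderDefectRecord
import Summits.QuantumFields.YangMills.Theorems.BalabanUVNodesN15NeumannCubeLiftNonlocalDefect
import HarnessLib

/-!
# THE GLUING STEP AT TWO LATTICE SPACINGS, XXXVIII: THE DISPLAYED IMAGES-TYPE ROW `HY` OF FILES 77–79 DISCHARGED BY dag-n15-a's N-IIm ∕ P-IIi — THE TWO-GRID η-DEFECT OF THE
# GLUED `U ≡ 1` OPERATOR OF THE COVER ON THE DOUBLED TORUS, AND THE PER-CUBE REMAINDER DEFECTS ON BOTH TORI, WITH NO DISPLAYED ROW (dag-n15-c g13, FILE 80; N15 = NE2, s1)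

Cell `pub-ymgap`, seat `pub-ymgap-dag-n15-c` (R134 (a); HUMAN RULING D-0062), generation 13.  `bears_on: R4∕N15 · K3⁷ SpineGivenEndpointR13SepCoPH (stmt-QuantumFields-20544)`.
Filed `--supports stmt-QuantumFields-20544 --as helper` — COUNT-NEUTRAL.  Theorems only (0 `def`, 0 `sorry`).  Imports BY NAME FILE 78 (`hasMaj_idef_knitGlued`; through it FILE 77
`hasMaj_idef_commOp_deltaOp_comp_knitG`), FILE 79 (`hasMaj_idef_commOp_deltaOp_comp_knitGR`) and dag-n15-a's P-IIi `hasMaj_idef_chiCube_nonlocal_liftCubeG` (through it N-IIm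
`hasMaj_idef_chiCube_nonlocal_neumannCubeG_succ`); nothing in the tree is modified.

WHAT.  FILES 77, 78 (doubled torus `2L^{m+1}`, cube side `L·L^m`) and 79 (torus of record `2L^{m_T}`, cube side `L^{s+1}`) each DISPLAY one images-type row `HY` — the two-grid
η-defect of `M_{χ_□} ∘ (a•Q*Q − ∂Π∂*) ∘ G(□)` (the nonlocal part `N_L` of Bałaban's `Δ_a` behind one cube propagator of the cover, cut at the cube) — which was dag-n15-c's
WANT-n15-a (g12-4).  dag-n15-a g21 LANDED it: N-IIm `hasMaj_idef_chiCube_nonlocal_neumannCubeG_succ` (doubled torus, any corner, rate `(L^k)^{−γ∕2}` for any `0 < γ < 1`) and P-IIi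
`hasMaj_idef_chiCube_nonlocal_liftCubeG` (torus of record, lifted cubes of side `L^s`, `s ≤ m_T`).  This file plugs them in at `γ = 1∕8` (`(L^k)^{−1∕16}`):
* §1 ★★ `knitG_nonlocalDefect_row` — the row `HY` of FILES 77∕78, hypothesis-free (N-IIm at the cover's corners); ★★★ **`hasMaj_idef_commOp_deltaOp_comp_knitG_closed`** (FILE 77's
  per-cube remainder defect, NO displayed row); ★★★ **`hasMaj_idef_knitGlued_closed`** — `∃ δ w₀ D > 0` (uniform in `m, k, r`): `𝔇(G′_glued, G_glued) ≤ D·(L^k)^{−1∕16}·e^{−δ|y−y′|_T}`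
  for `k ≥ 1`, `4 ≤ L^k`, `L^m ≥ w₀` on the doubled torus — FILE 78 with NO displayed row: the two-grid η-defect of the glued `U ≡ 1` operator of the cover assembled from CUBE data
  alone, every hypothesis of FILE 63 `hasMaj_idef_glued_of_cutRows` inhabited by a tree theorem.  With FILE 70 `knitGlued_spec` (iii) (`G_glued = Δ_a⁻¹` at each spacing for
  `L^m ≥ w₀`) this is the `U ≡ 1` TWO-GRID COMPOSITION CERTIFICATE of [B6] §2's parametrix machine with [B9] Thm 3.14's difference template on the doubled-cube torus.
* §2 ★★ `knitGR_nonlocalDefect_row` — the row `HY` of FILE 79, hypothesis-free (P-IIi at `s := s + 1`); ★★★ **`hasMaj_idef_commOp_deltaOp_comp_knitGR_closed`** (FILE 79's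
  per-cube remainder defect on the torus of record, constants free of the volume `m_T`, NO displayed row) — the per-cube input of the record-torus defect knit (next file).

HONEST FRAMING ∕ LIMITS.  Block-majorant bookkeeping over LANDED rows at `U ≡ 1` (no new analytic estimate; three `obtain`s and three applications).  On the doubled torus the
cube is half the torus, so as an ESTIMATE of `𝔇(G′, G)` §1 is circular through the torus letters feeding PROGRAMME N — what is certified is the COMPOSITION (every hypothesis
inhabited, guard `L^m ≥ w₀` and rate `(L^k)^{−1∕16}` live); §2's constants are free of the volume.  Nothing of [B5]∕[B6]∕[B9] asserted: [B9] Thm 3.14 = difference TEMPLATE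
only, [B6] (2.38)–(2.40) NOT asserted.  NE2⁺ NOT PRINTED, NOT proved; N15 NOT discharged; counts of record UNMOVED (typed 28∕28 · discharged 5∕27); one finite 𝕋⁴ at fixed ε per
index — NOT infinite volume, NOT OS on ℝ⁴, NOT a mass gap, NOT Clay; R4 closes the conditional finite-𝕋⁴ rung `BalabanLadder.UV` only.  Restate-immune.
-/

noncomputable section

namespace Summit.QuantumFields.YangMills.BalabanUVNodes.N15.Gluing

open Real
open Literature.MathematicalPhysics.QuantumFieldTheory.Balaban1983to89
open Literature.MathematicalPhysics.QuantumFieldTheory.Balaban1983to89.B5Prop11Plancherel (Tor fine)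
open Literature.MathematicalPhysics.QuantumFieldTheory.Balaban1983to89.B11SectG (BlockNorm HasMaj)
open Literature.MathematicalPhysics.QuantumFieldTheory.Balaban1983to89.T4EtaRateDefect (idef)
open Literature.MathematicalPhysics.QuantumFieldTheory.Balaban1983to89.T4EtaRateCoeffDefect (pull)
open Literature.MathematicalPhysics.QuantumFieldTheory.Balaban1983to89.B6Prop26Gluing (mulOp ind)
open Literature.MathematicalPhysics.QuantumFieldTheory.Balaban1983to89.B6UnitTorusCarrier (unitTorusGeo)
open Literature.MathematicalPhysics.QuantumFieldTheory.Balaban1983to89.B5SiteBridgeP12 (MP)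
open Literature.MathematicalPhysics.QuantumFieldTheory.King1986.Torus (blockOf tdistT)
open Summit.QuantumFields.YangMills.BalabanUVNodes.N15.VectorPiece (kingPrV)
open Summit.QuantumFields.YangMills.BalabanUVNodes.N15.TwoGrid (paramsOf deltaOp chiCube cubeBlocks landauRe qvRe qvAdjRe hasMaj_idef_chiCube_nonlocal_neumannCubeG_succ
  hasMaj_idef_chiCube_nonlocal_liftCubeG)

variable {d : ℕ}

/-! ## §1 The doubled torus: FILES 77 and 78 with no displayed row -/

section Doubled

variable {L : ℕ} [NeZero L]

/-- ★★ **THE IMAGES-TYPE ROW `HY` OF FILES 77∕78, HYPOTHESIS-FREE** — dag-n15-a N-IIm `hasMaj_idef_chiCube_nonlocal_neumannCubeG_succ` at the cover's corners and `γ = 1∕8`: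
`𝔇(M_{χ′_□}(a•Q*′Q′ − ∂′Π′∂′*)G′(□_k), M_{χ_□}(a•Q*Q − ∂Π∂*)G(□_k)) ≤ 1_□(y)1_□(y′)·m_Y·(L^k)^{−1∕16}·e^{−δ_Y|y−y′|_T}` on the doubled torus `2L^{m+1}`, cube side `L·L^m`, for
every `m`, `k ≥ 1`, `r` and cube index. [cite: Balaban1985BackgroundPropagators, Thm 3.14 pp.426–427 (difference template), (3.42) p.397 (shape); Balaban1984PropagatorsII, (2.37)
p.229, (2.133)–(2.134) p.247; Balaban1984PropagatorsI, (1.18) p.20, (1.110) p.35, (1.126) p.38] -/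
theorem knitG_nonlocalDefect_row (hL : Odd L ∧ 1 < L) {a : ℝ} (ha : 0 < a) :
    ∃ δY mY : ℝ, 0 < δY ∧ 0 ≤ mY ∧ ∀ (m kk r : ℕ) (_hk : 1 ≤ kk) (_hn4 : 4 ≤ L ^ kk) (k : Fin (d + 1) → ZMod (2 * L)),
      HasMaj (BlockNorm.ofBlocks (unitTorusGeo L kk (MP (paramsOf d L (m + 1) kk hL)))
          (fun b : Tor (fine (L ^ kk) (MP (paramsOf d L (m + 1) kk hL))) × Fin (d + 1) => blockOf (L ^ kk) (MP (paramsOf d L (m + 1) kk hL)) b.1))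
        (BlockNorm.ofBlocks (unitTorusGeo L kk (MP (paramsOf d L (m + 1) kk hL)))
          (fun i : Tor (fine (L ^ r * L ^ kk) (MP (paramsOf d L (m + 1) kk hL))) × Fin (d + 1) => blockOf (L ^ r * L ^ kk) (MP (paramsOf d L (m + 1) kk hL)) i.1))
        (idef (pull (kingPrV L kk r (MP (paramsOf d L (m + 1) kk hL)))) (pull (kingPrV L kk r (MP (paramsOf d L (m + 1) kk hL))))
          (mulOp (chiCube (MP (paramsOf d L (m + 1) kk hL)) (L ^ r * L ^ kk) (coverCorner (MP (paramsOf d L (m + 1) kk hL)) (L ^ m) L (coverMargin L m) k) (L * L ^ m)) ∘ₗ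
            ((a • (qvAdjRe (MP (paramsOf d L (m + 1) kk hL)) (L ^ r * L ^ kk) ∘ₗ qvRe (MP (paramsOf d L (m + 1) kk hL)) (L ^ r * L ^ kk)) +
                (-landauRe (MP (paramsOf d L (m + 1) kk hL)) (L ^ r * L ^ kk))) ∘ₗ knitG d L m kk (L ^ r * L ^ kk) hL a k))
          (mulOp (chiCube (MP (paramsOf d L (m + 1) kk hL)) (L ^ kk) (coverCorner (MP (paramsOf d L (m + 1) kk hL)) (L ^ m) L (coverMargin L m) k) (L * L ^ m)) ∘ₗ
            ((a • (qvAdjRe (MP (paramsOf d L (m + 1) kk hL)) (L ^ kk) ∘ₗ qvRe (MP (paramsOf d L (m + 1) kk hL)) (L ^ kk)) +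
                (-landauRe (MP (paramsOf d L (m + 1) kk hL)) (L ^ kk))) ∘ₗ knitG d L m kk (L ^ kk) hL a k)))
        (fun y y' => ind ((cubeBlocks (MP (paramsOf d L (m + 1) kk hL)) (coverCorner (MP (paramsOf d L (m + 1) kk hL)) (L ^ m) L (coverMargin L m) k) (L * L ^ m) : Finset _) : Set _) y *
          ind ((cubeBlocks (MP (paramsOf d L (m + 1) kk hL)) (coverCorner (MP (paramsOf d L (m + 1) kk hL)) (L ^ m) L (coverMargin L m) k) (L * L ^ m) : Finset _) : Set _) y' *
          (mY * ((L ^ kk : ℕ) : ℝ) ^ (-(1 / 16 : ℝ)) * Real.exp (-(δY * tdistT (MP (paramsOf d L (m + 1) kk hL)) y y')))) := by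
  obtain ⟨δ, m, hδ, hm, H⟩ := hasMaj_idef_chiCube_nonlocal_neumannCubeG_succ (d := d) hL.1 hL.2 ha (γ := 1 / 8) (by norm_num) (by norm_num)
  refine ⟨δ, m, hδ, hm.le, fun m' kk r hk _ k => ?_⟩
  have hexp16 : (-((1 : ℝ) / 8 / 2)) = -(1 / 16 : ℝ) := by norm_num
  have h := H m' kk r hk hL (coverCorner (MP (paramsOf d L (m' + 1) kk hL)) (L ^ m') L (coverMargin L m') k)
  rw [hexp16] at h
  exact h

/-- ★★★ **THE TWO-GRID η-DEFECT OF THE REMAINDER ROW OF ONE CUBE OF THE COVER ON THE DOUBLED TORUS — FILE 77 WITH NO DISPLAYED ROW**: there are `δ, C_r > 0` (uniform in `m`,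
`k`, `r` and the cube index) with `𝔇([Δ′_a, M_{h′_k}]G′(□_k), [Δ_a, M_{h_k}]G(□_k)) ≤ 1_□(y′)·C_r(L^k)^{−1∕16}·e^{−δ|y−y′|_T}` for `k ≥ 1`, `4 ≤ L^k`.
[cite: Balaban1984PropagatorsII, (2.92)–(2.93) p.239, (2.133)–(2.136) p.247 (shapes + mechanism); Balaban1985BackgroundPropagators, Thm 3.14 pp.426–427 (difference template);
Balaban1984PropagatorsI, (1.18) p.20, (1.69) p.29, (1.126) p.38 (shapes)] -/
theorem hasMaj_idef_commOp_deltaOp_comp_knitG_closed (hL : Odd L ∧ 1 < L) {a : ℝ} (ha : 0 < a) :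
    ∃ δ Cr : ℝ, 0 < δ ∧ 0 < Cr ∧ ∀ (m kk r : ℕ) (_hk : 1 ≤ kk) (_hn4 : 4 ≤ L ^ kk) (k : Fin (d + 1) → ZMod (2 * L)),
      HasMaj (BlockNorm.ofBlocks (unitTorusGeo L kk (MP (paramsOf d L (m + 1) kk hL)))
          (fun b : Tor (fine (L ^ kk) (MP (paramsOf d L (m + 1) kk hL))) × Fin (d + 1) => blockOf (L ^ kk) (MP (paramsOf d L (m + 1) kk hL)) b.1))
        (BlockNorm.ofBlocks (unitTorusGeo L kk (MP (paramsOf d L (m + 1) kk hL)))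
          (fun i : Tor (fine (L ^ r * L ^ kk) (MP (paramsOf d L (m + 1) kk hL))) × Fin (d + 1) => blockOf (L ^ r * L ^ kk) (MP (paramsOf d L (m + 1) kk hL)) i.1))
        (idef (pull (kingPrV L kk r (MP (paramsOf d L (m + 1) kk hL)))) (pull (kingPrV L kk r (MP (paramsOf d L (m + 1) kk hL))))
          (commOp (deltaOp (MP (paramsOf d L (m + 1) kk hL)) (L ^ r * L ^ kk) a) (knitH d L m kk (L ^ r * L ^ kk) hL k) ∘ₗ knitG d L m kk (L ^ r * L ^ kk) hL a k)
          (commOp (deltaOp (MP (paramsOf d L (m + 1) kk hL)) (L ^ kk) a) (knitH d L m kk (L ^ kk) hL k) ∘ₗ knitG d L m kk (L ^ kk) hL a k))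
        (fun y y' => ind ((cubeBlocks (MP (paramsOf d L (m + 1) kk hL)) (coverCorner (MP (paramsOf d L (m + 1) kk hL)) (L ^ m) L (coverMargin L m) k) (L * L ^ m) : Finset _) : Set _) y' *
          (Cr * ((L ^ kk : ℕ) : ℝ) ^ (-(1 / 16 : ℝ)) * Real.exp (-(δ * tdistT (MP (paramsOf d L (m + 1) kk hL)) y y')))) := by
  obtain ⟨δY, mY, hδY, hmY, HY⟩ := knitG_nonlocalDefect_row (d := d) hL ha
  exact hasMaj_idef_commOp_deltaOp_comp_knitG hL ha hδY hmY HY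

/-- ★★★ **THE TWO-GRID η-DEFECT OF THE GLUED `U ≡ 1` OPERATOR OF THE COVER ON THE DOUBLED TORUS, FROM CUBE DATA, NO DISPLAYED ROW**: for odd `L ≥ 3`, `a > 0` there are
`δ, w₀, D > 0` (uniform in `m, k, r`) with `𝔇(G′_glued, G_glued) ≤ D·(L^k)^{−1∕16}·e^{−δ|y−y′|_T}` whenever `k ≥ 1`, `4 ≤ L^k`, `L^m ≥ w₀` — FILE 78 `hasMaj_idef_knitGlued` with
its row `HY` supplied by §1; every hypothesis of FILE 63 `hasMaj_idef_glued_of_cutRows` is now a tree theorem.  With FILE 70 (iii) both members are the torus propagators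
`Δ_a⁻¹` at the two spacings. [cite: Balaban1984PropagatorsII, (2.36)–(2.37) p.229, (2.91)–(2.93) p.239, (2.133)–(2.136) p.247 (mechanism); Balaban1985BackgroundPropagators,
Thm 3.1 p.397 («M ≥ M₁»), Thm 3.14 pp.426–427 (difference template); Balaban1984PropagatorsI, (1.121)–(1.123) p.37] -/
theorem hasMaj_idef_knitGlued_closed (hL : Odd L ∧ 1 < L) {a : ℝ} (ha : 0 < a) :
    ∃ δ w₀ D : ℝ, 0 < δ ∧ 0 < D ∧ ∀ (m kk r : ℕ) (_hk : 1 ≤ kk) (_hn4 : 4 ≤ L ^ kk), w₀ ≤ ((L ^ m : ℕ) : ℝ) →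
      HasMaj (BlockNorm.ofBlocks (unitTorusGeo L kk (MP (paramsOf d L (m + 1) kk hL)))
          (fun b : Tor (fine (L ^ kk) (MP (paramsOf d L (m + 1) kk hL))) × Fin (d + 1) => blockOf (L ^ kk) (MP (paramsOf d L (m + 1) kk hL)) b.1))
        (BlockNorm.ofBlocks (unitTorusGeo L kk (MP (paramsOf d L (m + 1) kk hL)))
          (fun i : Tor (fine (L ^ r * L ^ kk) (MP (paramsOf d L (m + 1) kk hL))) × Fin (d + 1) => blockOf (L ^ r * L ^ kk) (MP (paramsOf d L (m + 1) kk hL)) i.1))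
        (idef (pull (kingPrV L kk r (MP (paramsOf d L (m + 1) kk hL)))) (pull (kingPrV L kk r (MP (paramsOf d L (m + 1) kk hL))))
          (knitGlued d L m kk (L ^ r * L ^ kk) hL a) (knitGlued d L m kk (L ^ kk) hL a))
        (fun y y' => D * ((L ^ kk : ℕ) : ℝ) ^ (-(1 / 16 : ℝ)) * Real.exp (-(δ * tdistT (MP (paramsOf d L (m + 1) kk hL)) y y'))) := by
  obtain ⟨δY, mY, hδY, hmY, HY⟩ := knitG_nonlocalDefect_row (d := d) hL ha
  exact hasMaj_idef_knitGlued hL ha hδY hmY HY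

end Doubled

/-! ## §2 The torus of record: FILE 79 with no displayed row -/

section Record

variable {L : ℕ} [NeZero L]

/-- ★★ **THE IMAGES-TYPE ROW `HY` OF FILE 79, HYPOTHESIS-FREE, UNIFORM IN THE VOLUME** — dag-n15-a P-IIi `hasMaj_idef_chiCube_nonlocal_liftCubeG` at the cover's corners, cube
side `L^{s+1}` (`s + 1 ≤ m_T`) and `γ = 1∕8`: `𝔇(M_{χ′_□}(a•Q*′Q′ − ∂′Π′∂′*)G′^{↑}(□_k), M_{χ_□}(a•Q*Q − ∂Π∂*)G^{↑}(□_k)) ≤ 1_□(y)1_□(y′)·m_Y·(L^K)^{−1∕16}·e^{−δ_Y|y−y′|_T}` on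
the torus of record `2L^{m_T}`. [cite: Balaban1985BackgroundPropagators, Thm 3.14 pp.426–427 (difference template), (3.42) p.397 (shape); Balaban1984PropagatorsII, p.238 (T_□),
(2.37) p.229, (2.133)–(2.134) p.247; Balaban1984PropagatorsI, (1.18) p.20, (1.110) p.35, (1.126) p.38] -/
theorem knitGR_nonlocalDefect_row (hL : Odd L ∧ 1 < L) {a : ℝ} (ha : 0 < a) :
    ∃ δY mY : ℝ, 0 < δY ∧ 0 ≤ mY ∧ ∀ (s mT K r : ℕ) (hs : s + 1 ≤ mT) (_hK : 1 ≤ K) (_hn4 : 4 ≤ L ^ K) (k : Fin (d + 1) → ZMod (2 * L ^ (mT - s))),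
      HasMaj (BlockNorm.ofBlocks (unitTorusGeo L K (MP (paramsOf d L mT K hL))) (fun b : Tor (fine (L ^ K) (MP (paramsOf d L mT K hL))) × Fin (d + 1) => blockOf (L ^ K) (MP (paramsOf d L mT K hL)) b.1))
        (BlockNorm.ofBlocks (unitTorusGeo L K (MP (paramsOf d L mT K hL))) (fun i : Tor (fine (L ^ r * L ^ K) (MP (paramsOf d L mT K hL))) × Fin (d + 1) => blockOf (L ^ r * L ^ K) (MP (paramsOf d L mT K hL)) i.1))
        (idef (pull (kingPrV L K r (MP (paramsOf d L mT K hL)))) (pull (kingPrV L K r (MP (paramsOf d L mT K hL))))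
          (mulOp (chiCube (MP (paramsOf d L mT K hL)) (L ^ r * L ^ K) (coverCorner (MP (paramsOf d L mT K hL)) (L ^ s) (L ^ (mT - s)) (coverMargin L s) k) (L ^ (s + 1))) ∘ₗ
            ((a • (qvAdjRe (MP (paramsOf d L mT K hL)) (L ^ r * L ^ K) ∘ₗ qvRe (MP (paramsOf d L mT K hL)) (L ^ r * L ^ K)) + (-landauRe (MP (paramsOf d L mT K hL)) (L ^ r * L ^ K))) ∘ₗ knitGR d L s mT K (L ^ r * L ^ K) hL hs a k))
          (mulOp (chiCube (MP (paramsOf d L mT K hL)) (L ^ K) (coverCorner (MP (paramsOf d L mT K hL)) (L ^ s) (L ^ (mT - s)) (coverMargin L s) k) (L ^ (s + 1))) ∘ₗ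
            ((a • (qvAdjRe (MP (paramsOf d L mT K hL)) (L ^ K) ∘ₗ qvRe (MP (paramsOf d L mT K hL)) (L ^ K)) + (-landauRe (MP (paramsOf d L mT K hL)) (L ^ K))) ∘ₗ knitGR d L s mT K (L ^ K) hL hs a k)))
        (fun y y' => ind ((cubeBlocks (MP (paramsOf d L mT K hL)) (coverCorner (MP (paramsOf d L mT K hL)) (L ^ s) (L ^ (mT - s)) (coverMargin L s) k) (L ^ (s + 1)) : Finset _) : Set _) y * ind ((cubeBlocks (MP (paramsOf d L mT K hL)) (coverCorner (MP (paramsOf d L mT K hL)) (L ^ s) (L ^ (mT - s)) (coverMargin L s) k) (L ^ (s + 1)) : Finset _) : Set _) y' *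
          (mY * ((L ^ K : ℕ) : ℝ) ^ (-(1 / 16 : ℝ)) * Real.exp (-(δY * tdistT (MP (paramsOf d L mT K hL)) y y')))) := by
  obtain ⟨δ, m, hδ, hm, H⟩ := hasMaj_idef_chiCube_nonlocal_liftCubeG (d := d) hL.1 hL.2 ha (γ := 1 / 8) (by norm_num) (by norm_num)
  refine ⟨δ, m, hδ, hm.le, fun s mT K r hs hK _ k => ?_⟩
  have hexp16 : (-((1 : ℝ) / 8 / 2)) = -(1 / 16 : ℝ) := by norm_num
  have h := H (s + 1) mT K r hK hL hs (coverCorner (MP (paramsOf d L mT K hL)) (L ^ s) (L ^ (mT - s)) (coverMargin L s) k)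
  rw [hexp16] at h
  exact h

/-- ★★★ **THE TWO-GRID η-DEFECT OF THE REMAINDER ROW OF ONE LIFTED CUBE OF THE COVER ON THE TORUS OF RECORD — FILE 79 WITH NO DISPLAYED ROW**: there are `δ, C_r > 0`, free of
the volume `m_T`, the cube exponent `s`, the spacings `K, r` and the cube index, with `𝔇([Δ′_a, M_{h′_k}]G′^{↑}(□_k), [Δ_a, M_{h_k}]G^{↑}(□_k)) ≤ 1_□(y′)·C_r(L^K)^{−1∕16}·e^{−δ|y−y′|_T}`
for `s + 1 ≤ m_T`, `K ≥ 1`, `4 ≤ L^K`. [cite: Balaban1984PropagatorsII, (2.92)–(2.93) p.239, (2.133)–(2.136) p.247 (shapes + mechanism); Balaban1985BackgroundPropagators, Thm 3.14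
pp.426–427 (difference template); Balaban1984PropagatorsI, (1.18) p.20, (1.69) p.29, (1.126) p.38 (shapes)] -/
theorem hasMaj_idef_commOp_deltaOp_comp_knitGR_closed (hL : Odd L ∧ 1 < L) {a : ℝ} (ha : 0 < a) :
    ∃ δ Cr : ℝ, 0 < δ ∧ 0 < Cr ∧ ∀ (s mT K r : ℕ) (hs : s + 1 ≤ mT) (_hK : 1 ≤ K) (_hn4 : 4 ≤ L ^ K) (k : Fin (d + 1) → ZMod (2 * L ^ (mT - s))),
      HasMaj (BlockNorm.ofBlocks (unitTorusGeo L K (MP (paramsOf d L mT K hL))) (fun b : Tor (fine (L ^ K) (MP (paramsOf d L mT K hL))) × Fin (d + 1) => blockOf (L ^ K) (MP (paramsOf d L mT K hL)) b.1))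
        (BlockNorm.ofBlocks (unitTorusGeo L K (MP (paramsOf d L mT K hL)))
          (fun i : Tor (fine (L ^ r * L ^ K) (MP (paramsOf d L mT K hL))) × Fin (d + 1) => blockOf (L ^ r * L ^ K) (MP (paramsOf d L mT K hL)) i.1))
        (idef (pull (kingPrV L K r (MP (paramsOf d L mT K hL)))) (pull (kingPrV L K r (MP (paramsOf d L mT K hL))))
          (commOp (deltaOp (MP (paramsOf d L mT K hL)) (L ^ r * L ^ K) a) (knitHR d L s mT K (L ^ r * L ^ K) hL k) ∘ₗ knitGR d L s mT K (L ^ r * L ^ K) hL hs a k)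
          (commOp (deltaOp (MP (paramsOf d L mT K hL)) (L ^ K) a) (knitHR d L s mT K (L ^ K) hL k) ∘ₗ knitGR d L s mT K (L ^ K) hL hs a k))
        (fun y y' => ind ((cubeBlocks (MP (paramsOf d L mT K hL)) (coverCorner (MP (paramsOf d L mT K hL)) (L ^ s) (L ^ (mT - s)) (coverMargin L s) k) (L ^ (s + 1)) : Finset _) : Set _) y' *
          (Cr * ((L ^ K : ℕ) : ℝ) ^ (-(1 / 16 : ℝ)) * Real.exp (-(δ * tdistT (MP (paramsOf d L mT K hL)) y y')))) := by
  obtain ⟨δY, mY, hδY, hmY, HY⟩ := knitGR_nonlocalDefect_row (d := d) hL ha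
  exact hasMaj_idef_commOp_deltaOp_comp_knitGR hL ha hδY hmY HY

end Record

end Summit.QuantumFields.YangMills.BalabanUVNodes.N15.Gluing

end
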